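import Literature.NumberTheory.Automorphic.IrreducibleClassesConstituents
import Mathlib.RingTheory.SimpleModule.Isotypic
import Mathlib.LinearAlgebra.Finsupp.Supported
import HarnessLib

/-!
# Constituents of direct sums and of isotypic semisimple representations

Sequel of ★ `IrreducibleClassesConstituents` (the calculus of ★ `IrrClass.IsConstituentOf c ρ`, «`c` is the class of an
irreducible smooth SUBQUOTIENT `N₁ ⁄ N₂` of `ρ`»).  The one fact of module theory it adds — WITHOUT any finite-length ∕ Jordan–Hölder
hypothesis — is the EXCHANGE LEMMA behind «the composition factors of an extension are those of its ends»:
* §1 for ANY intertwining map `f : ρ → τ`, a constituent of `ρ` is a constituent of `ker f` or is carried by `f` to a constituent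
  of `τ` (`IsConstituentOf.ker_or_of_intertwiningMap`): realise `c` as `N₁ ⁄ N₂`; if `N₁ ∩ ker f ≤ N₂` then `N₁ ⁄ N₂ ≅ f(N₁) ⁄ f(N₂)`,
  else the non-zero `G`-map `N₁ ∩ ker f → N₁ ⁄ N₂` is onto the irreducible quotient.  Corollaries: sub-or-quotient
  (`toRepresentation_or_quotientRep`), «left or right» for `ρ.prod σ`, no constituents on a trivial space, and LOCALISATION: a
  constituent of `ρ` is a constituent of every subrepresentation through some non-zero vector (`exists_mem_forall`);
* §2 DIRECT SUMS: every constituent of `⨁_I τ` (Mathlib `Representation.finsupp τ I` on `I →₀ W`) is a constituent of `τ`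
  (`IsConstituentOf.of_finsupp`) — localise to a vector (finite support) and peel off one coordinate at a time with §1 along the
  evaluation maps; also after restriction along `e : H →* G` (`of_finsupp_comp`);
* §3 ISOTYPIC SEMISIMPLE `ρ` (Mathlib `IsSemisimpleModule` + `IsIsotypicOfType` on `ρ.asModule`, e.g. from ★ R2♯
  `isIsotypicOfType_of_finitely_cogenerated`; or `isotypicComponent … = ⊤`): `ρ ≅ ⨁_I σ` (Mathlib
  `IsIsotypicOfType.linearEquiv_finsupp`), so every constituent of `ρ ∘ e` is a constituent of `σ ∘ e`
  (`IsConstituentOf.of_isIsotypicOfType_comp`) — «the `G_v`-constituents of the `σ`-isotypic smooth part of `P|_{U(𝔸_f)}` are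
  `G_v`-constituents of `σ`», as consumed by the A-packet membership transfer of [Rogawski1990, §13.1].
Standard ([BourbakiAlgebreVIII2012, VIII §4 n°1–2]; [BushnellHenniart2006, §2]); fully proved, theorems only (no definition, no named
fact, no instance); nothing declared in Mathlib's namespaces.  NOT here: Jordan–Hölder, multiplicities, anything automorphic.

## References
[BourbakiAlgebreVIII2012] VIII §4 n°1–2 (isotypic modules; sub-∕quotient modules of `⨁ S`) · [BushnellHenniart2006] §2 ·
[Rogawski1990] §13.1 p. 199.
-/

set_option autoImplicit false

noncomputable section

open scoped MonoidAlgebra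
open Literature.RepresentationTheory.FiniteGroups Literature.RepresentationTheory.Semisimple

namespace Literature.NumberTheory.Automorphic

namespace IrrClass

universe u u'

variable {G : Type u} [Group G] [TopologicalSpace G]

/-! ## §1 The exchange lemma: `ker f` or the image -/

section Exchange

variable {V W : Type*} [AddCommGroup V] [Module ℂ V] [AddCommGroup W] [Module ℂ W]

omit [TopologicalSpace G] in
/-- **Subquotients transport along an intertwining map whose kernel on `N₁` lies in `N₂`**: for `f : σ → ρ` and `G`-stable
`N₂ ≤ N₁` in `σ` with `N₁ ∩ ker f ≤ N₂`, the subquotient `N₁ ⁄ N₂` of `σ` is equivalent to `f(N₁) ⁄ f(N₂)` in `ρ`. [folklore] -/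
private theorem nonempty_equiv_subquotient_map_of_ker_le {σ : Representation ℂ G W} {ρ : Representation ℂ G V}
    (f : σ.IntertwiningMap ρ) (N₁ N₂ : Subrepresentation σ) (hle : N₂ ≤ N₁)
    (hker : ∀ x ∈ N₁, f x = 0 → x ∈ N₂) (M₁ M₂ : Subrepresentation ρ)
    (hM₁ : M₁.toSubmodule = N₁.toSubmodule.map f.toLinearMap) (hM₂ : M₂.toSubmodule = N₂.toSubmodule.map f.toLinearMap) :
    Nonempty ((N₁.toRepresentation.quotient (N₂.toSubmodule.comap N₁.toSubmodule.subtype)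
        fun g _ hx ↦ N₂.apply_mem_toSubmodule g hx).Equiv
      (M₁.toRepresentation.quotient (M₂.toSubmodule.comap M₁.toSubmodule.subtype)
        fun g _ hx ↦ M₂.apply_mem_toSubmodule g hx)) := by
  have hu : ∀ x : W, x ∈ N₁.toSubmodule → f.toLinearMap x ∈ M₁.toSubmodule := fun x hx => by
    rw [hM₁]; exact ⟨x, hx, rfl⟩
  let u : ↥N₁.toSubmodule →ₗ[ℂ] ↥M₁.toSubmodule := f.toLinearMap.restrict hu
  have hu_apply : ∀ x : ↥N₁.toSubmodule, ((u x : ↥M₁.toSubmodule) : V) = f (x : W) := fun x => rfl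
  set P : Submodule ℂ ↥N₁.toSubmodule := N₂.toSubmodule.comap N₁.toSubmodule.subtype with hPdef
  set Q : Submodule ℂ ↥M₁.toSubmodule := M₂.toSubmodule.comap M₁.toSubmodule.subtype with hQdef
  have hsurj : Function.Surjective (Q.mkQ ∘ₗ u) := by
    intro y
    obtain ⟨y, rfl⟩ := Submodule.Quotient.mk_surjective _ y
    have hy : (y : V) ∈ N₁.toSubmodule.map f.toLinearMap := hM₁ ▸ y.2
    obtain ⟨x, hx, hxy⟩ := hy
    refine ⟨⟨x, hx⟩, ?_⟩
    simp only [LinearMap.coe_comp, Function.comp_apply, Submodule.mkQ_apply]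
    exact congrArg Submodule.Quotient.mk (Subtype.ext hxy)
  have hkerEq : P = LinearMap.ker (Q.mkQ ∘ₗ u) := by
    ext x
    rw [LinearMap.mem_ker, LinearMap.comp_apply, Submodule.mkQ_apply, Submodule.Quotient.mk_eq_zero, hQdef, hPdef,
      Submodule.mem_comap, Submodule.mem_comap, Submodule.subtype_apply, Submodule.subtype_apply, hu_apply, hM₂]
    constructor
    · intro hx
      exact ⟨(x : W), hx, rfl⟩
    · rintro ⟨y, hy, hyx⟩
      have hd : (x : W) - y ∈ N₂ := by
        refine hker _ (N₁.toSubmodule.sub_mem x.2 (hle hy)) ?_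
        rw [map_sub, sub_eq_zero]
        exact hyx.symm
      simpa using N₂.toSubmodule.add_mem hd hy
  let χ : (↥N₁.toSubmodule ⧸ P) ≃ₗ[ℂ] (↥M₁.toSubmodule ⧸ Q) :=
    (Submodule.quotEquivOfEq _ _ hkerEq).trans (LinearMap.quotKerEquivOfSurjective _ hsurj)
  have hχ : ∀ x : ↥N₁.toSubmodule, χ (Submodule.Quotient.mk x) = Submodule.Quotient.mk (u x) := fun x => by
    simp only [χ, LinearEquiv.trans_apply, Submodule.quotEquivOfEq_mk, LinearMap.quotKerEquivOfSurjective_apply_mk,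
      LinearMap.coe_comp, Function.comp_apply, Submodule.mkQ_apply]
  refine ⟨Representation.Equiv.mk χ fun g => ?_⟩
  refine Submodule.linearMap_qext _ (LinearMap.ext fun x => ?_)
  simp only [LinearMap.coe_comp, LinearEquiv.coe_coe, Function.comp_apply, Submodule.mkQ_apply,
    Representation.quotient_apply, Submodule.mapQ_apply, hχ]
  refine congrArg Submodule.Quotient.mk (Subtype.ext ?_)
  simp only [hu_apply, Subrepresentation.toRepresentation_apply_coe]
  exact Representation.IntertwiningMap.isIntertwining _ _ f g (x : W)

/-- The exchange lemma, IMAGE case (on a realisation): if `⟦r⟧ ≅ N₁ ⁄ N₂` in `σ` and `N₁ ∩ ker f ≤ N₂` for an intertwining map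
`f : σ → ρ`, then `⟦r⟧` is a constituent of `ρ` (as `f(N₁) ⁄ f(N₂)`). [cite: BourbakiAlgebreVIII2012, VIII §4 n°1] -/
theorem isConstituentOf_of_realisation_of_ker_le {σ : Representation ℂ G W} {ρ : Representation ℂ G V}
    (f : σ.IntertwiningMap ρ) (r : SmoothIrrep G) (N₁ N₂ : Subrepresentation σ) (hle : N₂ ≤ N₁)
    (φ : r.ρ.Equiv (N₁.toRepresentation.quotient (N₂.toSubmodule.comap N₁.toSubmodule.subtype)
      fun g _ hx ↦ N₂.apply_mem_toSubmodule g hx))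
    (hker : ∀ x ∈ N₁, f x = 0 → x ∈ N₂) : (IrrClass.mk r).IsConstituentOf ρ := by
  have hstab : ∀ (N : Subrepresentation σ) (g : G) (v : V), v ∈ N.toSubmodule.map f.toLinearMap →
      ρ g v ∈ N.toSubmodule.map f.toLinearMap := by
    intro N g v hv
    obtain ⟨x, hx, rfl⟩ := hv
    exact ⟨σ g x, N.apply_mem_toSubmodule g hx, Representation.IntertwiningMap.isIntertwining _ _ f g x⟩
  let M₁ : Subrepresentation ρ := ⟨N₁.toSubmodule.map f.toLinearMap, fun g v hv => hstab N₁ g v hv⟩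
  let M₂ : Subrepresentation ρ := ⟨N₂.toSubmodule.map f.toLinearMap, fun g v hv => hstab N₂ g v hv⟩
  have hle' : M₂ ≤ M₁ := fun v hv => Submodule.map_mono (show N₂.toSubmodule ≤ N₁.toSubmodule from hle) hv
  obtain ⟨ψ⟩ := nonempty_equiv_subquotient_map_of_ker_le f N₁ N₂ hle hker M₁ M₂ rfl rfl
  exact ⟨r, rfl, M₁, M₂, hle', ⟨φ.trans ψ⟩⟩

/-- The exchange lemma, KERNEL case (on a realisation): if `⟦r⟧ ≅ N₁ ⁄ N₂` in `σ` and a subrepresentation `F` meets `N₁` outside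
`N₂`, then `⟦r⟧` is a constituent of `F` — the non-zero `G`-map `N₁ ∩ F → N₁ ⁄ N₂` is ONTO the irreducible quotient.
[cite: BourbakiAlgebreVIII2012, VIII §4 n°1] -/
theorem isConstituentOf_toRepresentation_of_realisation {σ : Representation ℂ G W} (r : SmoothIrrep G)
    (N₁ N₂ : Subrepresentation σ)
    (φ : r.ρ.Equiv (N₁.toRepresentation.quotient (N₂.toSubmodule.comap N₁.toSubmodule.subtype)
      fun g _ hx ↦ N₂.apply_mem_toSubmodule g hx))
    (F : Subrepresentation σ) {x : W} (hx₁ : x ∈ N₁) (hxF : x ∈ F) (hx₂ : x ∉ N₂) :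
    (IrrClass.mk r).IsConstituentOf F.toRepresentation := by
  -- `N₂` read inside `N₁`, and the irreducible quotient `Q = N₁ ⁄ N₂`
  let N₂' : Subrepresentation N₁.toRepresentation :=
    ⟨N₂.toSubmodule.comap N₁.toSubmodule.subtype, fun g _ hx ↦ N₂.apply_mem_toSubmodule g hx⟩
  have φ' : r.ρ.Equiv N₂'.quotientRep := φ
  haveI : N₂'.quotientRep.IsIrreducible := Representation.isIrreducible_of_equiv φ'
  -- the `G`-map `N₁ ∩ F → N₁ → N₁ ⁄ N₂`
  have hleN : (N₁ ⊓ F).toSubmodule ≤ N₁.toSubmodule := fun _ h => h.1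
  have hleF : (N₁ ⊓ F).toSubmodule ≤ F.toSubmodule := fun _ h => h.2
  let ι : (N₁ ⊓ F).toRepresentation.IntertwiningMap N₁.toRepresentation :=
    ⟨Submodule.inclusion hleN, fun g => LinearMap.ext fun _ => rfl⟩
  let π : (N₁ ⊓ F).toRepresentation.IntertwiningMap N₂'.quotientRep := N₂'.mkQ.comp ι
  -- it is non-zero at `x`, hence onto (the range is a non-zero subrepresentation of an irreducible)
  have hπx : π ⟨x, hx₁, hxF⟩ ≠ 0 := fun h0 =>
    hx₂ ((Subrepresentation.mkQ_eq_zero_iff N₂' _).1 (show N₂'.mkQ (ι ⟨x, hx₁, hxF⟩) = 0 from h0))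
  have hsurj : Function.Surjective π := by
    have htop : π.range = ⊤ := (IsSimpleOrder.eq_bot_or_eq_top π.range).resolve_left fun h => by
      have hmem : π ⟨x, hx₁, hxF⟩ ∈ π.range := ⟨_, rfl⟩
      rw [h] at hmem
      exact hπx ((Submodule.mem_bot ℂ).1 hmem)
    exact fun y => show y ∈ π.range by rw [htop]; trivial
  -- so `⟦r⟧`, a constituent of `Q`, is a constituent of `N₁ ∩ F`, hence of `F`
  have hQ : (IrrClass.mk r).IsConstituentOf N₂'.quotientRep :=
    (isConstituentOf_congr φ' _).1 (isConstituentOf_mk_self r)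
  exact (hQ.of_surjective π hsurj).of_injective ⟨Submodule.inclusion hleF, fun g => LinearMap.ext fun _ => rfl⟩
    fun a b hab => Submodule.inclusion_injective hleF hab

/-- **THE EXCHANGE LEMMA.** For any intertwining map `f : ρ → τ`, every constituent of `ρ` is a constituent of `ker f` (Mathlib
`IntertwiningMap.ker`, a subrepresentation) or — carried by `f` — a constituent of `τ`.  No finite-length hypothesis.
[cite: BourbakiAlgebreVIII2012, VIII §4 n°1] -/
theorem IsConstituentOf.ker_or_of_intertwiningMap {ρ : Representation ℂ G V} {τ : Representation ℂ G W}
    (f : ρ.IntertwiningMap τ) {c : IrrClass G} (h : c.IsConstituentOf ρ) :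
    c.IsConstituentOf f.ker.toRepresentation ∨ c.IsConstituentOf τ := by
  obtain ⟨r, rfl, N₁, N₂, hle, ⟨φ⟩⟩ := h
  by_cases hcase : ∃ x ∈ N₁, f x = 0 ∧ x ∉ N₂
  · obtain ⟨x, hx₁, hfx, hx₂⟩ := hcase
    exact Or.inl (isConstituentOf_toRepresentation_of_realisation r N₁ N₂ φ f.ker hx₁ hfx hx₂)
  · exact Or.inr (isConstituentOf_of_realisation_of_ker_le f r N₁ N₂ hle φ fun x hx hfx =>
      by_contra fun hx₂ => hcase ⟨x, hx, hfx, hx₂⟩)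

/-- **Sub-or-quotient**: for a subrepresentation `F` of `ρ`, every constituent of `ρ` is a constituent of `F` or of `ρ ⁄ F`
(★ `Subrepresentation.quotientRep`). [cite: BourbakiAlgebreVIII2012, VIII §4 n°1] -/
theorem IsConstituentOf.toRepresentation_or_quotientRep {ρ : Representation ℂ G V} (F : Subrepresentation ρ)
    {c : IrrClass G} (h : c.IsConstituentOf ρ) :
    c.IsConstituentOf F.toRepresentation ∨ c.IsConstituentOf F.quotientRep := by
  rcases h.ker_or_of_intertwiningMap F.mkQ with h₁ | h₂
  · have hle : F.mkQ.ker.toSubmodule ≤ F.toSubmodule := fun v hv => (F.mkQ_eq_zero_iff v).1 hv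
    exact Or.inl (h₁.of_injective ⟨Submodule.inclusion hle, fun g => LinearMap.ext fun _ => rfl⟩
      fun a b hab => Submodule.inclusion_injective hle hab)
  · exact Or.inr h₂

/-- **Left or right**: every constituent of `ρ.prod σ` (Mathlib `Representation.prod`, on `V × W`) is a constituent of `ρ` or
of `σ` (exchange along the second projection, whose kernel is the image of the first inclusion). [cite: BourbakiAlgebreVIII2012, VIII §4 n°1] -/
theorem IsConstituentOf.left_or_right_of_prod {ρ : Representation ℂ G V} {σ : Representation ℂ G W} {c : IrrClass G}
    (h : c.IsConstituentOf (ρ.prod σ)) : c.IsConstituentOf ρ ∨ c.IsConstituentOf σ := by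
  rcases h.ker_or_of_intertwiningMap (Representation.IntertwiningMap.snd ℂ ρ σ) with h₁ | h₂
  · left
    rw [← Representation.IntertwiningMap.range_inl] at h₁
    have hinj : Function.Injective (Representation.IntertwiningMap.inl ℂ ρ σ) :=
      Function.LeftInverse.injective (g := Representation.IntertwiningMap.fst ℂ ρ σ) fun a => by
        rw [← Representation.IntertwiningMap.comp_apply, Representation.IntertwiningMap.fst_comp_inl]
        rfl
    exact (isConstituentOf_congr (Subrepresentation.equivRange (Representation.IntertwiningMap.inl ℂ ρ σ) hinj) c).2 h₁
  · exact Or.inr h₂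

omit [TopologicalSpace G] in
/-- No constituents on a trivial space. [cite: BushnellHenniart2006, §2] -/
theorem not_isConstituentOf_of_subsingleton [TopologicalSpace G] [Subsingleton V] (ρ : Representation ℂ G V)
    (c : IrrClass G) : ¬ c.IsConstituentOf ρ := by
  rintro ⟨r, -, N₁, N₂, -, ⟨φ⟩⟩
  haveI := nontrivial_of_isIrreducible r.ρ
  haveI : Subsingleton (↥N₁.toSubmodule ⧸ N₂.toSubmodule.comap N₁.toSubmodule.subtype) :=
    (Submodule.Quotient.mk_surjective _).subsingleton
  exact not_subsingleton r.V φ.toLinearEquiv.injective.subsingleton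

/-- **Localisation to a vector**: a constituent of `ρ` is a constituent of EVERY subrepresentation containing a suitable non-zero
vector `x` (any `x ∈ N₁ ∖ N₂` of a realisation `N₁ ⁄ N₂`). [cite: BourbakiAlgebreVIII2012, VIII §4 n°1] -/
theorem IsConstituentOf.exists_mem_forall {ρ : Representation ℂ G V} {c : IrrClass G} (h : c.IsConstituentOf ρ) :
    ∃ x : V, x ≠ 0 ∧ ∀ F : Subrepresentation ρ, x ∈ F → c.IsConstituentOf F.toRepresentation := by
  obtain ⟨r, rfl, N₁, N₂, -, ⟨φ⟩⟩ := h
  -- some `x ∈ N₁ ∖ N₂` (else `N₁ ⁄ N₂ = 0`)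
  have hne : ∃ x ∈ N₁, x ∉ N₂ := by
    by_contra hne
    have hcon : ∀ x ∈ N₁, x ∈ N₂ := fun x hx => by_contra fun h => hne ⟨x, hx, h⟩
    have htop : N₂.toSubmodule.comap N₁.toSubmodule.subtype = ⊤ :=
      eq_top_iff.2 fun y _ => hcon _ y.2
    haveI := nontrivial_of_isIrreducible r.ρ
    haveI : Subsingleton (↥N₁.toSubmodule ⧸ N₂.toSubmodule.comap N₁.toSubmodule.subtype) :=
      (Submodule.Quotient.subsingleton_iff).2 htop
    exact not_subsingleton r.V φ.toLinearEquiv.injective.subsingleton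
  obtain ⟨x, hx₁, hx₂⟩ := hne
  refine ⟨x, fun h0 => hx₂ (h0 ▸ N₂.toSubmodule.zero_mem), fun F hxF => ?_⟩
  exact isConstituentOf_toRepresentation_of_realisation r N₁ N₂ φ F hx₁ hxF hx₂

end Exchange

/-! ## §2 Direct sums `⨁_I τ` = Mathlib `Representation.finsupp τ I` -/

section Finsupp

variable {W : Type*} [AddCommGroup W] [Module ℂ W]

omit [TopologicalSpace G] in
/-- `⨁_I τ` acts coordinatewise: `(τ.finsupp I) g f = f.mapRange (τ g)`. [folklore] -/
private theorem finsupp_apply_eq_mapRange (τ : Representation ℂ G W) (I : Type*) (g : G) (f : I →₀ W) :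
    (τ.finsupp I) g f = Finsupp.mapRange (τ g) (map_zero _) f := by
  have h : (τ.finsupp I) g = Finsupp.mapRange.linearMap (τ g) := by
    refine Finsupp.lhom_ext' fun i => LinearMap.ext fun w => ?_
    simp [Representation.finsupp_single]
  rw [h]
  rfl

/-- **Every constituent of a direct sum `⨁_I τ` is a constituent of `τ`** — for an arbitrary index type `I` and WITHOUT any
finite-length hypothesis on `τ`: localise the constituent to the subrepresentation of vectors supported on the (finite) support
of one vector (`exists_mem_forall`), then remove one coordinate at a time by the exchange lemma along the evaluation maps
`f ↦ f a` (kernel = vectors supported off `a`). [cite: BourbakiAlgebreVIII2012, VIII §4 n°2] -/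
theorem IsConstituentOf.of_finsupp {τ : Representation ℂ G W} {I : Type*} {c : IrrClass G}
    (h : c.IsConstituentOf (τ.finsupp I)) : c.IsConstituentOf τ := by
  classical
  -- the subrepresentations `S s` of vectors supported in `s ⊆ I`
  have hstab : ∀ (s : Set I) (g : G) (f : I →₀ W), f ∈ Finsupp.supported W ℂ s →
      (τ.finsupp I) g f ∈ Finsupp.supported W ℂ s := by
    intro s g f hf
    rw [Finsupp.mem_supported] at hf ⊢
    rw [finsupp_apply_eq_mapRange]
    exact Set.Subset.trans (Finset.coe_subset.2 Finsupp.support_mapRange) hf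
  let S : Set I → Subrepresentation (τ.finsupp I) := fun s => ⟨Finsupp.supported W ℂ s, fun g f hf => hstab s g f hf⟩
  have hmemS : ∀ (s : Set I) (f : I →₀ W), f ∈ S s ↔ ↑f.support ⊆ s := fun s f => Finsupp.mem_supported ℂ f
  -- induction on a finite support set
  have key : ∀ (s : Finset I) (c : IrrClass G), c.IsConstituentOf (S ↑s).toRepresentation → c.IsConstituentOf τ := by
    intro s
    induction s using Finset.induction_on with
    | empty =>
      intro c hc
      have h0 : ∀ z : ↥(S ↑(∅ : Finset I)).toSubmodule, (z : I →₀ W) = 0 := fun z => by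
        ext i
        by_contra hi
        have hi' := (hmemS _ _).1 z.2 (Finset.mem_coe.2 (Finsupp.mem_support_iff.2 hi))
        simp at hi'
      haveI : Subsingleton ↥(S ↑(∅ : Finset I)).toSubmodule := ⟨fun a b => Subtype.ext ((h0 a).trans (h0 b).symm)⟩
      exact absurd hc (not_isConstituentOf_of_subsingleton _ _)
    | insert a s ha ih =>
      intro c hc
      -- evaluation at `a` : `S (insert a s) → τ`, an intertwining map
      let ev : (S ↑(insert a s)).toRepresentation.IntertwiningMap τ :=
        ⟨(Finsupp.lapply a).comp (S ↑(insert a s)).toSubmodule.subtype, fun g => LinearMap.ext fun f => by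
          simp only [LinearMap.coe_comp, Function.comp_apply, Submodule.subtype_apply, Finsupp.lapply_apply,
            Subrepresentation.toRepresentation_apply_coe]
          change ((τ.finsupp I) g (f : I →₀ W)) a = τ g ((f : I →₀ W) a)
          rw [finsupp_apply_eq_mapRange, Finsupp.mapRange_apply]⟩
      rcases hc.ker_or_of_intertwiningMap ev with hk | hτ
      · -- `ker ev` embeds in `S s`
        have hmem : ∀ f : ↥ev.ker.toSubmodule, ((f : ↥(S ↑(insert a s)).toSubmodule) : I →₀ W) ∈ (S ↑s).toSubmodule := by
          intro f
          have hfa : ((f : ↥(S ↑(insert a s)).toSubmodule) : I →₀ W) a = 0 := f.2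
          have hsub : ↑((f : ↥(S ↑(insert a s)).toSubmodule) : I →₀ W).support ⊆ (↑(insert a s) : Set I) :=
            (hmemS _ _).1 (f : ↥(S ↑(insert a s)).toSubmodule).2
          refine (hmemS _ _).2 fun i hi => ?_
          have hi' := hsub hi
          rw [Finset.coe_insert, Set.mem_insert_iff] at hi'
          rcases hi' with rfl | hi'
          · exact absurd hfa (Finsupp.mem_support_iff.1 (Finset.mem_coe.1 hi))
          · exact hi'
        refine ih c (hk.of_injective
          ⟨LinearMap.codRestrict (S ↑s).toSubmodule
              ((S ↑(insert a s)).toSubmodule.subtype ∘ₗ ev.ker.toSubmodule.subtype) hmem,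
            fun g => LinearMap.ext fun f => Subtype.ext rfl⟩
          fun f f' hff' => Subtype.ext (Subtype.ext ?_))
        exact congrArg (fun y : ↥(S ↑s).toSubmodule => (y : I →₀ W)) hff'
      · exact hτ
  -- localise `c` to the support of one vector
  obtain ⟨x, -, hx⟩ := h.exists_mem_forall
  exact key x.support c (hx (S ↑x.support) ((hmemS _ _).2 subset_rfl))

omit [TopologicalSpace G] in
/-- `(⨁_I τ) ∘ e = ⨁_I (τ ∘ e)` for a group homomorphism `e : H →* G`. [folklore] -/
private theorem finsupp_comp {H : Type u'} [Group H] (τ : Representation ℂ G W) (I : Type*) (e : H →* G) :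
    (τ.finsupp I).comp e = Representation.finsupp (τ.comp e) I :=
  MonoidHom.ext fun _ => rfl

omit [TopologicalSpace G] in
/-- Direct sums commute with restriction: every constituent of `(⨁_I τ) ∘ e` is a constituent of `τ ∘ e`, for any group
homomorphism `e : H →* G`. [cite: BourbakiAlgebreVIII2012, VIII §4 n°2] -/
theorem IsConstituentOf.of_finsupp_comp {H : Type u'} [Group H] [TopologicalSpace H] {τ : Representation ℂ G W}
    {I : Type*} (e : H →* G) {c : IrrClass H} (h : c.IsConstituentOf ((τ.finsupp I).comp e)) :
    c.IsConstituentOf (τ.comp e) := by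
  rw [finsupp_comp] at h
  exact h.of_finsupp

end Finsupp

/-! ## §3 Isotypic semisimple representations -/

section Isotypic

variable {V W : Type*} [AddCommGroup V] [Module ℂ V] [AddCommGroup W] [Module ℂ W]

omit [TopologicalSpace G] in
/-- A `ℂ[G]`-linear isomorphism `ρ.asModule ≃ (I →₀ σ.asModule)` is an equivalence of representations `ρ ≅ ⨁_I σ`. [folklore] -/
private theorem nonempty_equiv_finsupp_of_linearEquiv {ρ : Representation ℂ G V} {σ : Representation ℂ G W} {I : Type*}
    (e : ρ.asModule ≃ₗ[ℂ[G]] (I →₀ σ.asModule)) : Nonempty (ρ.Equiv (σ.finsupp I)) := by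
  -- the same map, `ℂ`-linearly, on the underlying spaces
  let eV : V ≃ₗ[ℂ] (I →₀ W) :=
    ρ.asModuleEquiv.symm.trans ((e.restrictScalars ℂ).trans (Finsupp.mapRange.linearEquiv σ.asModuleEquiv))
  have heV : ∀ (v : V) (i : I), eV v i = σ.asModuleEquiv (e (ρ.asModuleEquiv.symm v) i) := fun v i => by
    simp only [eV, LinearEquiv.trans_apply, LinearEquiv.restrictScalars_apply, Finsupp.mapRange.linearEquiv_apply,
      Finsupp.mapRange_apply]
  refine ⟨Representation.Equiv.mk eV fun g => LinearMap.ext fun v => Finsupp.ext fun i => ?_⟩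
  simp only [LinearMap.coe_comp, LinearEquiv.coe_coe, Function.comp_apply]
  rw [finsupp_apply_eq_mapRange, Finsupp.mapRange_apply, heV, heV, Representation.asModuleEquiv_symm_map_rho, map_smul,
    Finsupp.smul_apply, MonoidAlgebra.of_apply, Representation.single_smul, one_smul]
  rfl

omit [TopologicalSpace G] in
/-- **Constituents of a representation `ℂ[G]`-isomorphic to a direct sum `⨁_I σ` are constituents of `σ`, also after restriction
along `e : H →* G`.** [cite: BourbakiAlgebreVIII2012, VIII §4 n°2] -/
theorem IsConstituentOf.of_linearEquiv_finsupp_comp {H : Type u'} [Group H] [TopologicalSpace H]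
    {ρ : Representation ℂ G V} {σ : Representation ℂ G W} {I : Type*} (e : ρ.asModule ≃ₗ[ℂ[G]] (I →₀ σ.asModule))
    (φ : H →* G) {c : IrrClass H} (h : c.IsConstituentOf (ρ.comp φ)) : c.IsConstituentOf (σ.comp φ) := by
  obtain ⟨E⟩ := nonempty_equiv_finsupp_of_linearEquiv e
  have h' : c.IsConstituentOf ((σ.finsupp I).comp φ) :=
    h.of_injective (σ := ρ.comp φ) (ρ := (σ.finsupp I).comp φ) ⟨E.toLinearMap, fun x => E.isIntertwining' (φ x)⟩
      E.toLinearEquiv.injective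
  exact h'.of_finsupp_comp φ

omit [TopologicalSpace G] in
/-- **Constituents of a σ-ISOTYPIC SEMISIMPLE representation, restricted along `e : H →* G`, are constituents of `σ ∘ e`.**
Hypotheses in Mathlib's module currency on `ρ.asModule` (`IsSemisimpleModule`, `IsIsotypicOfType … σ.asModule`; supplied e.g. by
★ R2♯ `isSemisimpleModule_of_finitely_cogenerated` ∕ `isIsotypicOfType_of_finitely_cogenerated`); then `ρ ≅ ⨁_I σ` (Mathlib
`IsIsotypicOfType.linearEquiv_finsupp`) and §2 applies.  With `e = inclPlace v` this is «the `U(J)(F_v)`-constituents of the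
`σ`-isotypic smooth part of `P|_{U(J)(𝔸_{F,f})}` are `U(J)(F_v)`-constituents of `σ`». [cite: BourbakiAlgebreVIII2012, VIII §4 n°2] -/
theorem IsConstituentOf.of_isIsotypicOfType_comp {H : Type u'} [Group H] [TopologicalSpace H] {ρ : Representation ℂ G V} {σ : Representation ℂ G W}
    [IsSemisimpleModule ℂ[G] ρ.asModule] (hiso : IsIsotypicOfType ℂ[G] ρ.asModule σ.asModule) (e : H →* G)
    {c : IrrClass H} (h : c.IsConstituentOf (ρ.comp e)) : c.IsConstituentOf (σ.comp e) := by
  obtain ⟨I, ⟨eI⟩⟩ := hiso.linearEquiv_finsupp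
  exact h.of_linearEquiv_finsupp_comp eI e

/-- The same without restriction (`e = id`): constituents of a σ-isotypic semisimple `ρ` are constituents of `σ`.
[cite: BourbakiAlgebreVIII2012, VIII §4 n°2] -/
theorem IsConstituentOf.of_isIsotypicOfType {ρ : Representation ℂ G V}
    {σ : Representation ℂ G W} [IsSemisimpleModule ℂ[G] ρ.asModule] (hiso : IsIsotypicOfType ℂ[G] ρ.asModule σ.asModule)
    {c : IrrClass G} (h : c.IsConstituentOf ρ) : c.IsConstituentOf σ :=
  h.of_isIsotypicOfType_comp (H := G) hiso (MonoidHom.id G)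

omit [TopologicalSpace G] in
/-- Entry through Mathlib's `isotypicComponent`: if `isotypicComponent ℂ[G] ρ.asModule S = ⊤` for a simple `ℂ[G]`-module `S`
isomorphic to `σ.asModule` (★ R2♯ `isotypicComponent_eq_top_of_finitely_cogenerated` currency), the constituents of `ρ ∘ e` are
constituents of `σ ∘ e`. [cite: BourbakiAlgebreVIII2012, VIII §4 n°2] -/
theorem IsConstituentOf.of_isotypicComponent_eq_top_comp {H : Type u'} [Group H] [TopologicalSpace H] {ρ : Representation ℂ G V} {σ : Representation ℂ G W}
    [IsSimpleModule ℂ[G] σ.asModule] (htop : isotypicComponent ℂ[G] ρ.asModule σ.asModule = ⊤) (e : H →* G)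
    {c : IrrClass H} (h : c.IsConstituentOf (ρ.comp e)) : c.IsConstituentOf (σ.comp e) := by
  have hiso : IsIsotypicOfType ℂ[G] ρ.asModule σ.asModule := IsIsotypicOfType.of_isotypicComponent_eq_top htop
  haveI : IsSemisimpleModule ℂ[G] ρ.asModule := by
    refine IsSemisimpleModule.of_sSup_simples_eq_top (top_le_iff.1 ?_)
    unfold isotypicComponent at htop
    rw [← htop]
    exact sSup_le_sSup fun m hm => hm.elim fun e' => IsSimpleModule.congr e'
  exact h.of_isIsotypicOfType_comp hiso e

end Isotypic

end IrrClass

end Literature.NumberTheory.Automorphic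

end
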